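import Literature.Geometry.Riemannian.RoundCylinderThree
import Literature.Geometry.Riemannian.RoundCylinderFourVolume
import HarnessLib

/-!
# The round cylinder `S²(√2) × ℝ ≅ (ℝ³ ∖ 0, 2|y|⁻² δ)`: weighted volume `16π√π e^{-1}`,
# completeness, and disjunct (b) of `threeShrinkerClassification_modelData` (topic `Geometry/Riemannian`)

Second file of the three-dimensional round-cylinder model (see `RoundCylinderThree.lean`; the
template is `RoundCylinderFourVolume.lean`). With `hC` the cylinder metric as a Mathlib
`ContMDiffRiemannianMetric` and `dV = riemannianMeasure hC`:

* `chartGramMatrix_hC`, `sqrt_det_chartGramMatrix_hC` — in the single (inclusion) chart the Gram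
  matrix is `e^{2u} · 1` and the density is `√det = 2√2/|y|³`;
* `lintegral_exp_neg_fP_eq` — `∫ e^{-f} dV = ∫_{ℝ³} 2√2 e^{-f} |y|⁻³ dy`;
* `integral_radial_Grad`, `integral_Grad_norm` — polar coordinates (`|B³| = 4π/3`) and the
  substitution `t = eˣ` turn it into `4π · 2√2 e^{-1} ∫ e^{-x²/2} dx`; **`lintegral_exp_neg_fP`**:
  `∫ e^{-f} dV_{g_c} = 16 π √π e^{-1}` — the constant of disjunct (b) of the named fact
  `Literature.Geometry.Riemannian.threeShrinkerClassification_modelData` (Munteanu–Wang 2016,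
  proof of Thm. 5.1, p. 21: `Φ(S² × ℝ) = Φ(S²) = 4π e^{-1} (4π)^{1/2}`, i.e.
  `∫ e^{-f} = (4π)^{3/2} Φ = 16π√π e^{-1}`);
* `ofReal_abs_zP_sub_le_edist` (`|z(x) − z(y)| ≤ d_{g_c}(x,y)` for the height `z = √2 log|y|`) and
  **`isCompact_setOf_edist_le`** — closed `g_c`-balls are compact;
* **`cylinderSoliton_three_hypotheses`**, **`cylinderSoliton_three_modelData`** — the model is a
  member of the binder of the fact (complete, `f` smooth, `Ric + Hess f = ½ g`, `R + |∇f|² = f`)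
  and realises disjunct (b): `R ≡ 1` and `∫⁻ e^{-f} dV = 16π√π e^{-1}` (non-vacuity of (b)).

Everything is proved; no definitions of `Prop` type, no named facts (D-0026).

## References

* O. Munteanu, J. Wang, arXiv:1606.01861, Thm. 1.2 (p. 3) and proof of Thm. 5.1 (p. 21).
  [MunteanuWang2016]
* H.-D. Cao, R. S. Hamilton, T. Ilmanen, arXiv:math/0404165 (2004), §4 (Gaussian densities of
  cylinders). [CaoHamiltonIlmanen2004]
* H. Federer, *Geometric Measure Theory*, 1969, §3.2.46 (Riemannian measure in charts). [Federer1969]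
-/

noncomputable section

open Bundle Set Function Filter Manifold Metric Module TopologicalSpace
open scoped Manifold ContDiff Topology RealInnerProductSpace ENNReal NNReal

namespace Literature.Geometry.Riemannian

open Lorentzian Lorentzian.PseudoRiemannianMetric
open _root_.MeasureTheory _root_.MeasureTheory.Measure

namespace RoundCylinderThree

/-! ## The weighted volume `∫ e^{-f} dV_{g_c} = 16 π √π e^{-1}` -/

section Measure

/-- The cylinder metric as a Mathlib `ContMDiffRiemannianMetric` (argument of `riemannianMeasure`). [folklore] -/
abbrev hC : ContMDiffRiemannianMetric 𝓘(ℝ, E3) ∞ E3 (TangentSpace 𝓘(ℝ, E3) : P3 → Type _) :=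
  cyl3.toContMDiffRiemannianMetric isRiemannian_cyl3

/-- The Gram matrix of the cylinder metric in its (single, inclusion) chart: `e^{2u(y)} · 1`. [folklore] -/
theorem chartGramMatrix_hC (x₀ : P3) {y : E3} (hy : y ∈ (punctured : Set E3)) :
    chartGramMatrix hC x₀ y = Real.exp (2 * uE y) • (1 : Matrix (Fin 3) (Fin 3) ℝ) := by
  have hyt : y ∈ (extChartAt 𝓘(ℝ, E3) x₀).target := by
    rw [OpensChart.extChartAt_target]; exact hy
  have hsv : ((extChartAt 𝓘(ℝ, E3) x₀).symm y : E3) = y := OpensChart.extChartAt_symm_val x₀ hy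
  ext i j
  rw [chartGramMatrix_eq_inner_symmL hC x₀ hyt i j, OpensSection.symmL_apply, OpensSection.symmL_apply]
  change cyl3.val ((extChartAt 𝓘(ℝ, E3) x₀).symm y) (EuclideanSpace.single i 1)
    (EuclideanSpace.single j 1) = _
  change Real.exp (2 * uE ((extChartAt 𝓘(ℝ, E3) x₀).symm y : E3)) *
    ⟪(EuclideanSpace.single i (1 : ℝ) : E3), EuclideanSpace.single j 1⟫ = _
  rw [hsv, Matrix.smul_apply, Matrix.one_apply, smul_eq_mul]
  simp [EuclideanSpace.inner_single_left]

/-- The Riemannian density of the cylinder in its chart: `√det (g_c)_{ij}(y) = 2√2/|y|³`. [folklore] -/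
theorem sqrt_det_chartGramMatrix_hC (x₀ : P3) {y : E3} (hy : y ≠ 0) :
    Real.sqrt (chartGramMatrix hC x₀ y).det = 2 * Real.sqrt 2 / ‖y‖ ^ 3 := by
  rw [chartGramMatrix_hC x₀ (show y ∈ (punctured : Set E3) from hy), Matrix.det_smul,
    Matrix.det_one, mul_one, Fintype.card_fin, exp_two_uE hy]
  have hn : 0 < ‖y‖ := norm_pos_iff.mpr hy
  have h2 : Real.sqrt 2 ^ 2 = 2 := Real.sq_sqrt (by norm_num)
  have h : (2 / ‖y‖ ^ 2) ^ 3 = (2 * Real.sqrt 2 / ‖y‖ ^ 3) ^ 2 := by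
    field_simp
    nlinarith [h2]
  rw [h, Real.sqrt_sq (by positivity)]

/-- `ℝ³ ∖ {0}` is measurable. [folklore] -/
theorem measurableSet_punctured : MeasurableSet (punctured : Set E3) :=
  isOpen_compl_singleton.measurableSet

/-- **The weighted volume of the cylinder as a Euclidean integral**:
`∫ e^{-f} dV_{g_c} = ∫_{ℝ³} 2√2 e^{-f(y)} |y|⁻³ dy` (single chart = inclusion, density `2√2/|y|³`,
`{0}` is Lebesgue-null). [folklore] -/
theorem lintegral_exp_neg_fP_eq :
    ∫⁻ p, ENNReal.ofReal (Real.exp (-fP p)) ∂(riemannianMeasure hC) =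
      ∫⁻ y : E3, ENNReal.ofReal (Real.exp (-fE y) * (2 * Real.sqrt 2 / ‖y‖ ^ 3)) := by
  haveI : Nonempty P3 := ⟨⟨EuclideanSpace.single 0 1, by simp [punctured]⟩⟩
  have measurable_uE : Measurable uE :=
    (measurable_const.mul measurable_const).sub
      (measurable_const.mul (Real.measurable_log.comp (measurable_norm.pow_const 2)))
  have measurable_fE : Measurable fE :=
    ((((measurable_const.mul measurable_const).sub measurable_uE).pow_const 2).div_const 2).add
      measurable_const
  set x₀ : P3 := Classical.arbitrary P3
  have hmap := map_extChartAt_restrict_riemannianMeasure hC x₀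
  rw [OpensChart.extChartAt_source, Measure.restrict_univ, OpensChart.extChartAt_coe,
    OpensChart.extChartAt_target] at hmap
  have hemb : MeasurableEmbedding (Subtype.val : P3 → E3) :=
    MeasurableEmbedding.subtype_coe measurableSet_punctured
  have h1 : ∫⁻ p, ENNReal.ofReal (Real.exp (-fP p)) ∂(riemannianMeasure hC) =
      ∫⁻ y, ENNReal.ofReal (Real.exp (-fE y)) ∂((riemannianMeasure hC).map Subtype.val) := by
    rw [hemb.lintegral_map]; rfl
  rw [h1, hmap, lintegral_withDensity_eq_lintegral_mul₀
    (aemeasurable_ofReal_sqrt_det_chartGramMatrix hC x₀ |>.mono_measure (by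
      rw [OpensChart.extChartAt_target])) (by
      apply Measurable.aemeasurable
      apply Measurable.ennreal_ofReal
      exact (Real.measurable_exp.comp (measurable_fE.neg)))]
  have hU : (punctured : Set E3) = {(0 : E3)}ᶜ := rfl
  rw [hU, restrict_compl_singleton]
  refine lintegral_congr_ae ?_
  filter_upwards [compl_mem_ae_iff.mpr (measure_singleton (0 : E3))] with y hy
  have hy0 : y ≠ 0 := hy
  rw [Pi.mul_apply, sqrt_det_chartGramMatrix_hC x₀ hy0, ← ENNReal.ofReal_mul (by positivity), mul_comm]

/-! ### The radial integral `∫_{ℝ³} 2√2 e^{-f} |y|⁻³ dy = 16 π √π e^{-1}` -/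

/-- The radial profile of the integrand: `G(t) = 2√2 e^{-(log² t/2 + 1)} t⁻³`. [folklore] -/
def Grad (t : ℝ) : ℝ := Real.exp (-((Real.log t) ^ 2 / 2 + 1)) * (2 * Real.sqrt 2 / t ^ 3)

/-- The integrand is radial. [folklore] -/
theorem integrand_eq_Grad_norm {y : E3} (hy : y ≠ 0) :
    Real.exp (-fE y) * (2 * Real.sqrt 2 / ‖y‖ ^ 3) = Grad ‖y‖ := by
  rw [Grad, fE, LE_eq_log hy]

/-- Substitution `t = eˣ`: the pulled-back radial integrand is a Gaussian. [folklore] -/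
theorem radial_subst (x : ℝ) :
    |Real.exp x| • (Real.exp x ^ 2 * Grad (Real.exp x)) =
      2 * Real.sqrt 2 * Real.exp (-1) * Real.exp (-2⁻¹ * x ^ 2) := by
  rw [abs_of_pos (Real.exp_pos x), smul_eq_mul, Grad, Real.log_exp]
  have hx : Real.exp x ≠ 0 := (Real.exp_pos x).ne'
  have h4 : Real.exp x * (Real.exp x ^ 2 * (2 * Real.sqrt 2 / Real.exp x ^ 3)) = 2 * Real.sqrt 2 := by
    field_simp
  have hexp : Real.exp (-(x ^ 2 / 2 + 1)) = Real.exp (-1) * Real.exp (-2⁻¹ * x ^ 2) := by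
    rw [← Real.exp_add]; ring_nf
  calc Real.exp x * (Real.exp x ^ 2 * (Real.exp (-(x ^ 2 / 2 + 1)) * (2 * Real.sqrt 2 / Real.exp x ^ 3)))
      = Real.exp (-(x ^ 2 / 2 + 1)) * (Real.exp x * (Real.exp x ^ 2 * (2 * Real.sqrt 2 / Real.exp x ^ 3))) := by
        ring
    _ = 2 * Real.sqrt 2 * Real.exp (-1) * Real.exp (-2⁻¹ * x ^ 2) := by rw [h4, hexp]; ring

/-- `∫₀^∞ t² G(t) dt = 2√2 e^{-1} √(2π)`, with integrability (substitution `t = eˣ`, Gaussian integral). [folklore] -/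
theorem integral_radial_Grad :
    ∫ t in Ioi (0 : ℝ), t ^ 2 * Grad t = 2 * Real.sqrt 2 * Real.exp (-1) * Real.sqrt (2 * Real.pi) ∧
      IntegrableOn (fun t : ℝ ↦ t ^ 2 * Grad t) (Ioi 0) := by
  have himage : Real.exp '' univ = Ioi 0 := by rw [image_univ, Real.range_exp]
  have hderiv : ∀ x ∈ (univ : Set ℝ), HasDerivWithinAt Real.exp (Real.exp x) univ x :=
    fun x _ ↦ (Real.hasDerivAt_exp x).hasDerivWithinAt
  have hinj : InjOn Real.exp univ := Real.exp_injective.injOn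
  have hfun : (fun x : ℝ ↦ |Real.exp x| • (Real.exp x ^ 2 * Grad (Real.exp x))) =
      fun x ↦ 2 * Real.sqrt 2 * Real.exp (-1) * Real.exp (-2⁻¹ * x ^ 2) := funext radial_subst
  have hgauss : ∫ x : ℝ, Real.exp (-2⁻¹ * x ^ 2) = Real.sqrt (2 * Real.pi) := by
    rw [integral_gaussian (2⁻¹ : ℝ)]
    congr 1
    field_simp
  refine ⟨?_, ?_⟩
  · rw [← himage, integral_image_eq_integral_abs_deriv_smul MeasurableSet.univ hderiv hinj,
      Measure.restrict_univ, hfun, integral_const_mul, hgauss]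
  · rw [← himage, integrableOn_image_iff_integrableOn_abs_deriv_smul MeasurableSet.univ hderiv hinj,
      integrableOn_univ, hfun]
    exact (integrable_exp_neg_mul_sq (by norm_num : (0 : ℝ) < 2⁻¹)).const_mul _

/-- **`∫_{ℝ³} G(|y|) dy = 16 π √π e^{-1}`** (polar coordinates, `|B³| = 4π/3`, `3 · 4π/3 = |S²|`). [folklore] -/
theorem integral_Grad_norm :
    ∫ y : E3, Grad ‖y‖ = 16 * Real.pi * Real.sqrt Real.pi * Real.exp (-1) ∧
      Integrable (fun y : E3 ↦ Grad ‖y‖) := by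
  obtain ⟨hI, hint⟩ := integral_radial_Grad
  have hdim : finrank ℝ E3 = 3 := finrank_euclideanSpace_fin
  have hball : (volume : Measure E3).real (ball 0 1) = 4 * Real.pi / 3 := by
    rw [Measure.real, InnerProductSpace.volume_ball_of_dim_odd (k := 1) (by rw [hdim]), hdim]
    rw [ENNReal.toReal_mul, ← ENNReal.ofReal_pow zero_le_one, ENNReal.toReal_ofReal (by positivity),
      ENNReal.toReal_ofReal (by positivity)]
    norm_num [Nat.doubleFactorial]
    ring
  have hsq : Real.sqrt (2 * Real.pi) = Real.sqrt 2 * Real.sqrt Real.pi :=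
    Real.sqrt_mul (by norm_num) _
  have h22 : Real.sqrt 2 * Real.sqrt 2 = 2 := Real.mul_self_sqrt (by norm_num)
  refine ⟨?_, ?_⟩
  · have h := integral_fun_norm_addHaar (volume : Measure E3) Grad
    rw [h, hdim, hball]
    simp only [smul_eq_mul, nsmul_eq_mul, Nat.cast_ofNat]
    have h3 : ∫ t in Ioi (0 : ℝ), t ^ (3 - 1) * Grad t =
        2 * Real.sqrt 2 * Real.exp (-1) * Real.sqrt (2 * Real.pi) := by
      simpa using hI
    rw [h3, hsq]
    linear_combination (8 * Real.pi * Real.sqrt Real.pi * Real.exp (-1)) * h22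
  · refine (integrable_fun_norm_addHaar (volume : Measure E3) (f := Grad)).2 ?_
    rw [hdim]
    simpa [smul_eq_mul] using hint

/-- The Euclidean integral of the cylinder integrand. [folklore] -/
theorem integral_cylinder_integrand :
    ∫ y : E3, Real.exp (-fE y) * (2 * Real.sqrt 2 / ‖y‖ ^ 3) = 16 * Real.pi * Real.sqrt Real.pi * Real.exp (-1) ∧
      Integrable (fun y : E3 ↦ Real.exp (-fE y) * (2 * Real.sqrt 2 / ‖y‖ ^ 3)) := by
  obtain ⟨hI, hint⟩ := integral_Grad_norm
  have hae : (fun y : E3 ↦ Real.exp (-fE y) * (2 * Real.sqrt 2 / ‖y‖ ^ 3)) =ᵐ[volume]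
      fun y ↦ Grad ‖y‖ := by
    filter_upwards [compl_mem_ae_iff.mpr (measure_singleton (0 : E3))] with y hy
    exact integrand_eq_Grad_norm hy
  exact ⟨(integral_congr_ae hae).trans hI, hint.congr hae.symm⟩

/-- **The weighted volume of the round cylinder `S²(√2) × ℝ`**: `∫ e^{-f} dV_{g_c} = 16 π √π e^{-1}`
(`= (4π)^{3/2} Φ(S² × ℝ)`, Munteanu–Wang 2016, proof of Thm. 5.1) — the constant of disjunct (b)
of `threeShrinkerClassification_modelData`. [cite: MunteanuWang2016, proof of Thm. 5.1 (p. 21)] -/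
theorem lintegral_exp_neg_fP :
    ∫⁻ p, ENNReal.ofReal (Real.exp (-fP p)) ∂(riemannianMeasure hC) =
      ENNReal.ofReal (16 * Real.pi * Real.sqrt Real.pi * Real.exp (-1)) := by
  obtain ⟨hI, hint⟩ := integral_cylinder_integrand
  rw [lintegral_exp_neg_fP_eq, ← hI, ofReal_integral_eq_lintegral_ofReal hint
    (ae_of_all _ fun y ↦ by
      have : 0 ≤ 2 * Real.sqrt 2 / ‖y‖ ^ 3 := by positivity
      positivity)]

end Measure

/-! ## Completeness: closed `g_c`-balls are compact -/

section Complete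

/-- The height `z = √2 log |y|`, the `ℝ`-coordinate of `S²(√2) × ℝ`. [folklore] -/
def zP (y : P3) : ℝ := Real.sqrt 2 * LE y

/-- `z` is smooth. [folklore] -/
theorem contMDiff_zP : ContMDiff 𝓘(ℝ, E3) 𝓘(ℝ) ∞ zP := by
  have h : ContDiffOn ℝ ∞ (fun y ↦ Real.sqrt 2 * LE y) {y : E3 | y ≠ 0} :=
    fun y hy ↦ (contDiffAt_const.mul (contDiffAt_LE hy)).contDiffWithinAt
  exact h.contMDiffOn.comp_contMDiff contMDiff_subtype_val fun y ↦ coe_ne_zero y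

/-- `dz(v) = √2⟪x,v⟫/|x|²`. [folklore] -/
theorem mvfderiv_zP (x : P3) (v : E3) :
    mvfderiv 𝓘(ℝ, E3) zP x v = Real.sqrt 2 * ⟪(x : E3), v⟫ / ‖(x : E3)‖ ^ 2 := by
  have hx := coe_ne_zero x
  have hd : HasFDerivAt (fun y ↦ Real.sqrt 2 * LE y) ((Real.sqrt 2 : ℝ) • ((‖(x : E3)‖ ^ 2)⁻¹ •
      innerSL ℝ (x : E3))) x := (hasFDerivAt_LE hx).const_mul (Real.sqrt 2)
  rw [OpensChart.mvfderiv_eq x zP (fun y ↦ Real.sqrt 2 * LE y) (fun _ ↦ rfl) hd.differentiableAt v,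
    hd.fderiv]
  simp only [_root_.smul_apply, innerSL_apply_apply, smul_eq_mul]
  ring

/-- `|dz(v)| ≤ |v|_{g_c}`: the height is `1`-Lipschitz for the cylinder metric. [folklore] -/
theorem abs_mvfderiv_zP_le (x : P3) (v : E3) :
    |mvfderiv 𝓘(ℝ, E3) zP x v| ≤ (1 : NNReal) * Real.sqrt (cyl3.val x v v) := by
  have hn : 0 < ‖(x : E3)‖ := norm_pos x
  have hs2 : 0 < Real.sqrt 2 := Real.sqrt_pos.2 (by norm_num)
  have h22 : Real.sqrt 2 ^ 2 = 2 := Real.sq_sqrt (by norm_num)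
  rw [mvfderiv_zP, cyl3_apply, real_inner_self_eq_norm_sq, NNReal.coe_one, one_mul]
  have hsq : Real.sqrt (2 / ‖(x : E3)‖ ^ 2 * ‖v‖ ^ 2) = Real.sqrt 2 * ‖v‖ / ‖(x : E3)‖ := by
    rw [show 2 / ‖(x : E3)‖ ^ 2 * ‖v‖ ^ 2 = (Real.sqrt 2 * ‖v‖ / ‖(x : E3)‖) ^ 2 by
      rw [div_pow, mul_pow, h22]; ring, Real.sqrt_sq (by positivity)]
  rw [hsq, abs_div, abs_mul, abs_of_pos hs2, abs_of_pos (pow_pos hn 2),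
    div_le_div_iff₀ (pow_pos hn 2) hn]
  have hcs := abs_real_inner_le_norm (x : E3) v
  have h := mul_le_mul_of_nonneg_left hcs (le_of_lt (mul_pos hs2 hn))
  nlinarith [h]

/-- **The height difference bounds the distance from below**: `|z(x) − z(y)| ≤ d_{g_c}(x, y)`. [folklore] -/
theorem ofReal_abs_zP_sub_le_edist (x y : P3) :
    ENNReal.ofReal |zP x - zP y| ≤ cyl3.edist isRiemannian_cyl3 x y := by
  by_cases hfin : cyl3.edist isRiemannian_cyl3 x y = ⊤
  · rw [hfin]; exact le_top
  have hy : y ∈ cyl3.ball x ⊤ := by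
    rw [PseudoRiemannianMetric.mem_ball, PseudoRiemannianMetric.riemEDist_eq isRiemannian_cyl3]
    exact lt_top_iff_ne_top.mpr hfin
  have h := ofReal_abs_sub_le_mul_riemEDist cyl3 isRiemannian_cyl3 isOpen_univ
    (contMDiff_zP.of_le (by norm_cast)).contMDiffOn (L := 1)
    (fun z _ v ↦ abs_mvfderiv_zP_le z v) (subset_univ (cyl3.ball x ⊤)) hy
  rwa [ENNReal.coe_one, one_mul, PseudoRiemannianMetric.riemEDist_eq isRiemannian_cyl3] at h

/-- The annulus `{a ≤ |y| ≤ b}` in `ℝ³` is compact. [folklore] -/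
theorem isCompact_annulus (a b : ℝ) : IsCompact {y : E3 | a ≤ ‖y‖ ∧ ‖y‖ ≤ b} := by
  have h : {y : E3 | a ≤ ‖y‖ ∧ ‖y‖ ≤ b} = Metric.closedBall 0 b ∩ {y | a ≤ ‖y‖} := by
    ext y; simp [and_comm]
  rw [h]
  exact (isCompact_closedBall 0 b).inter_right (isClosed_le continuous_const continuous_norm)

/-- **Completeness of the cylinder**: closed `g_c`-balls are compact (closed and contained in a
compact annulus, since `|√2 log|x| − √2 log|y|| ≤ d(x,y)`). [folklore] -/
theorem isCompact_setOf_edist_le (x : P3) (r : NNReal) :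
    IsCompact {y : P3 | cyl3.edist isRiemannian_cyl3 x y ≤ r} := by
  have hs2 : 0 < Real.sqrt 2 := Real.sqrt_pos.2 (by norm_num)
  set a : ℝ := ‖(x : E3)‖ * Real.exp (-(r : ℝ) / Real.sqrt 2) with ha
  set b : ℝ := ‖(x : E3)‖ * Real.exp ((r : ℝ) / Real.sqrt 2) with hb
  have ha0 : 0 < a := mul_pos (norm_pos x) (Real.exp_pos _)
  have hK : IsCompact ((Subtype.val : P3 → E3) ⁻¹' {y | a ≤ ‖y‖ ∧ ‖y‖ ≤ b}) := by
    refine Topology.IsEmbedding.subtypeVal.isCompact_iff.mpr ?_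
    have himg : (Subtype.val : P3 → E3) '' ((Subtype.val : P3 → E3) ⁻¹' {y | a ≤ ‖y‖ ∧ ‖y‖ ≤ b}) =
        {y | a ≤ ‖y‖ ∧ ‖y‖ ≤ b} := by
      rw [image_preimage_eq_inter_range, Subtype.range_coe_subtype]
      refine inter_eq_left.mpr fun y hy ↦ ?_
      have : y ≠ 0 := fun h0 ↦ by
        simp only [h0, mem_setOf_eq, norm_zero] at hy; linarith [hy.1]
      exact this
    rw [himg]
    exact isCompact_annulus a b
  have hclosed : IsClosed {y : P3 | cyl3.edist isRiemannian_cyl3 x y ≤ r} :=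
    isClosed_le ((PseudoRiemannianMetric.continuous_edist isRiemannian_cyl3).comp
      (Continuous.prodMk_right x)) continuous_const
  refine hK.of_isClosed_subset hclosed fun y hy ↦ ?_
  have hz : |zP x - zP y| ≤ r := by
    have h := (ofReal_abs_zP_sub_le_edist x y).trans hy
    rwa [ENNReal.ofReal_le_coe] at h
  have hx0 := coe_ne_zero x
  have hy0 := coe_ne_zero y
  rw [zP, zP, LE_eq_log hx0, LE_eq_log hy0] at hz
  have hz' : |Real.log ‖(x : E3)‖ - Real.log ‖(y : E3)‖| ≤ r / Real.sqrt 2 := by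
    rw [← mul_sub, abs_mul, abs_of_pos hs2] at hz
    rw [le_div_iff₀ hs2]; linarith
  obtain ⟨h1, h2⟩ := abs_le.mp hz'
  refine ⟨?_, ?_⟩
  · rw [ha, ← Real.log_le_log_iff ha0 (norm_pos y), Real.log_mul (norm_pos x).ne' (Real.exp_pos _).ne',
      Real.log_exp]
    have : -(r : ℝ) / Real.sqrt 2 = -((r : ℝ) / Real.sqrt 2) := by ring
    linarith
  · rw [hb, ← Real.log_le_log_iff (norm_pos y) (mul_pos (norm_pos x) (Real.exp_pos _)),
      Real.log_mul (norm_pos x).ne' (Real.exp_pos _).ne', Real.log_exp]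
    linarith

end Complete

/-! ## The model realises disjunct (b) of `threeShrinkerClassification_modelData` -/

section ModelData

/-- **The round cylinder `(ℝ³ ∖ 0, 2|y|⁻²δ, (log|y|)²/2 + 1)` satisfies the four hypotheses of
`threeShrinkerClassification_modelData`**: closed distance balls are compact, the potential is
smooth, `Ric + Hess f = ½ g_c`, `R + |∇f|² = f`. [cite: MunteanuWang2016, Thm. 1.2 (p. 3)] -/
theorem cylinderSoliton_three_hypotheses :
    (∀ (x : P3) (r : NNReal), IsCompact {y : P3 | cyl3.edist isRiemannian_cyl3 x y ≤ r}) ∧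
    ContMDiff (𝓡 3) 𝓘(ℝ, ℝ) ∞ fP ∧
    (∀ (x : P3) (X Y : TangentSpace (𝓡 3) x),
      cyl3.ricci x X Y + cyl3.hessian fP x X Y = (1 / 2 : ℝ) * cyl3.val x X Y) ∧
    (∀ x : P3, cyl3.scalarCurvature x + cyl3.gradSq fP x = fP x) :=
  ⟨isCompact_setOf_edist_le, contMDiff_fP, soliton, normalisation⟩

/-- **The round cylinder realises disjunct (b) with the stated constant**: `R ≡ 1` and
`∫⁻ e^{-f} dV_{g_c} = 16π√π e^{-1}` (non-vacuity of case (b) of the fact; Munteanu–Wang 2016,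
proof of Thm. 5.1: `Φ(ℝ × S²) = Φ(S²) = 4π e^{-1} (4π)^{1/2}`).
[cite: MunteanuWang2016, proof of Thm. 5.1 (p. 21)] -/
theorem cylinderSoliton_three_modelData :
    (∀ x : P3, cyl3.scalarCurvature x = 1) ∧
    ∫⁻ x, ENNReal.ofReal (Real.exp (-fP x))
        ∂(riemannianMeasure (cyl3.toContMDiffRiemannianMetric isRiemannian_cyl3)) =
      ENNReal.ofReal (16 * Real.pi * Real.sqrt Real.pi * Real.exp (-1)) :=
  ⟨scalarCurvature_cyl3, lintegral_exp_neg_fP⟩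

end ModelData

end RoundCylinderThree

end Literature.Geometry.Riemannian

end
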